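import Mathlib
import HarnessLib
import Summits.HubbardSuperconductivity.HubbardSuperconductivity.Theorems.WeakCouplingBCSKlLindhardEnclosureGate

/-!
# KL-MARGIN-SCAN reader (22) «kernel-lindhard-enclosure» — TIP RULE, analytic core (generic calculus; cell gate-hubbard-kl, seat p4 g25)

The ceiling kernel's TIP RULE (`Params.ceilTip`/`Params.tipVariant`, `…LindhardEnclosureKernel` §3b) bounds `∫_cell F`, `F ≤ 1/(|e₁| + |e₂|)`, on a
cell where both `e₁ = ε_p − μ` and `e₂ = ε_{p+q} − μ` may vanish, by slicing in the direction in which `e₁` (or `e₂`) is monotone with speed `≥ v`,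
comparing the other function along the slice with Lipschitz constant `m` (Gate §5 `tip_slice_ineq`), and integrating the resulting logarithm
across the slices against the distance to the cell minimiser of `|e₁| + |e₂|` (Gate §5 `mv_matrix_bound`).  This file proves the GENERIC
one-variable calculus of that argument — no records, no `Params`:

* §1 `tip_pointwise` — `|e₁| ≥ v·d`, `|e₂| ≥ c − m·d`, `0 < v·d + c` ⇒ `1/(|e₁| + |e₂|) ≤ (1 + m/v)/(v·d + c)`;
* §2 `integral_comp_abs_sub_le_two_mul` — symmetric-decreasing comparison: for `g` antitone on `(0, ∞)`,
  `∫_{y₀}^{y₀+h} g(|y − y⋆|) dy ≤ 2·∫₀^{h/2} g` (any `y⋆`);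
* §3 `integral_inv_linear_abs_le` — `∫_{y₀}^{y₀+h} dy/(v|y − y⋆| + c) ≤ (2/v)·log(1 + v h/(2c))` (`v, c > 0`);
* §4 `integral_log_one_add_div_abs_le` — `∫_{x₀}^{x₀+h} (log(|x − x†| + A) − log|x − x†|) dx ≤ h·log(1 + 2A/h) + h` (`A, h > 0`; the integrand is
  `log(1 + A/|x − x†|)` off `x = x†`; `integral_log` through `0` and `log(1 + s) ≤ s`).

These reproduce the shape of `Params.tipVariant`: `2·(v+m)/v² · (dz/U) · (log(1 + Z₁) + 1)`.  Honest framing: calculus lemmas only; nothing here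
asserts `CeilTipSoundOrd`, a χ₀ enclosure, a margin, `K₃`, `U₀`, the window or superconductivity.
References: idea-4 r11 Core §3b/§5 (tree: `…LindhardEnclosureKernel`, `…LindhardEnclosureGate`); G. H. Hardy, J. E. Littlewood, G. Pólya,
*Inequalities* (1952), §10.12 (378) (rearrangement of a symmetric decreasing function).
-/

noncomputable section

set_option linter.dupNamespace false

namespace Summit.HubbardSuperconductivity.HubbardSuperconductivity.Theorems.KlLindhardEnclosure

open Real Set MeasureTheory intervalIntegral

/-! ## §1 The pointwise slice majorant -/

/-- **Pointwise tip majorant**: if `|e₁| ≥ v·d`, `|e₂| ≥ c − m·d` (`v > 0`, `m ≥ 0`, `v·d + c > 0`) then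
`1/(|e₁| + |e₂|) ≤ (1 + m/v)/(v·d + c)` (from Gate §5 `tip_slice_ineq` with `a = |e₁| − v d`, `w = v d`, `λ = m/v`). [folklore] -/
theorem tip_pointwise {e₁ e₂ v m c d : ℝ} (hv : 0 < v) (hm : 0 ≤ m)
    (h1 : v * d ≤ |e₁|) (h2 : c - m * d ≤ |e₂|) (hpos : 0 < v * d + c) :
    1 / (|e₁| + |e₂|) ≤ (1 + m / v) / (v * d + c) := by
  have hl : 0 ≤ m / v := div_nonneg hm hv.le
  have ha : 0 ≤ |e₁| - v * d := by linarith
  have key := tip_slice_ineq (a := |e₁| - v * d) (w := v * d) (c := c) (l := m / v) ha hl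
  have hmvd : m / v * (v * d) = m * d := by field_simp
  rw [hmvd, show |e₁| - v * d + v * d = |e₁| by ring] at key
  have hmax : max 0 (c - m * d) ≤ |e₂| := max_le (abs_nonneg _) h2
  have hsum : (|e₁| + c) / (1 + m / v) ≤ |e₁| + |e₂| := by linarith
  have h1l : 0 < 1 + m / v := by linarith
  have hq : 0 < (v * d + c) / (1 + m / v) := div_pos hpos h1l
  have hq' : (v * d + c) / (1 + m / v) ≤ (|e₁| + c) / (1 + m / v) := by gcongr
  have hE : 0 < |e₁| + |e₂| := lt_of_lt_of_le hq (hq'.trans hsum)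
  rw [div_le_div_iff₀ hE hpos]
  calc 1 * (v * d + c) ≤ |e₁| + c := by linarith
    _ = (1 + m / v) * ((|e₁| + c) / (1 + m / v)) := by field_simp
    _ ≤ (1 + m / v) * (|e₁| + |e₂|) := by gcongr

/-! ## §2 Symmetric-decreasing comparison: `∫ g(|y − y⋆|) ≤ 2 ∫₀^{h/2} g` -/

section Rearrangement

variable {g : ℝ → ℝ} (hg : AntitoneOn g (Ioi 0)) (hint : ∀ a b : ℝ, IntervalIntegrable g volume a b)
include hg hint

/-- Shift comparison: for `0 ≤ a ≤ b` and `δ ≥ 0`, `∫_a^b g(s + δ) ds ≤ ∫_a^b g(s) ds` (`g` antitone on `(0, ∞)`). [folklore] -/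
theorem integral_comp_add_right_le_of_antitoneOn {a b δ : ℝ} (ha : 0 ≤ a) (hab : a ≤ b) (hδ : 0 ≤ δ) :
    ∫ s in a..b, g (s + δ) ≤ ∫ s in a..b, g s := by
  have hI : IntervalIntegrable (fun s => g (s + δ)) volume a b := by
    simpa using (hint (a + δ) (b + δ)).comp_add_right δ
  have hne : ∀ᵐ s ∂(volume : Measure ℝ), s ≠ (0 : ℝ) := by
    rw [ae_iff]
    simp
  refine intervalIntegral.integral_mono_ae_restrict hab hI (hint a b) ?_
  filter_upwards [ae_restrict_mem measurableSet_Icc, ae_restrict_of_ae hne] with s hs hs0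
  have hs0' : 0 < s := lt_of_le_of_ne (ha.trans hs.1) (Ne.symm hs0)
  exact hg (mem_Ioi.2 hs0') (mem_Ioi.2 (by linarith)) (by linarith)

/-- `∫_a^b g = ∫_0^{b−a} g(· + a) ≤ ∫_0^{b−a} g` for `0 ≤ a ≤ b`. [folklore] -/
theorem integral_le_integral_from_zero {a b : ℝ} (ha : 0 ≤ a) (hab : a ≤ b) :
    ∫ s in a..b, g s ≤ ∫ s in (0 : ℝ)..(b - a), g s := by
  have h := intervalIntegral.integral_comp_add_right g a (a := 0) (b := b - a)
  simp only [zero_add, sub_add_cancel] at h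
  rw [← h]
  exact integral_comp_add_right_le_of_antitoneOn hg hint le_rfl (by linarith) ha

/-- `∫_0^l g ≤ 2 ∫_0^{l/2} g` for `l ≥ 0`. [folklore] -/
theorem integral_zero_le_two_mul_half {l : ℝ} (hl : 0 ≤ l) :
    ∫ s in (0 : ℝ)..l, g s ≤ 2 * ∫ s in (0 : ℝ)..(l / 2), g s := by
  have hsplit := (intervalIntegral.integral_add_adjacent_intervals (hint 0 (l / 2)) (hint (l / 2) l)).symm
  rw [hsplit]
  have h2 : ∫ s in (l / 2)..l, g s ≤ ∫ s in (0 : ℝ)..(l / 2), g s := by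
    have := integral_le_integral_from_zero hg hint (a := l / 2) (b := l) (by linarith) (by linarith)
    rwa [show l - l / 2 = l / 2 by ring] at this
  linarith

/-- Two pieces from `0` of total length `≤ l`: `∫_0^α g + ∫_0^β g ≤ 2 ∫_0^{l/2} g` (`α, β ≥ 0`, `α + β = l`). [folklore] -/
theorem integral_two_pieces_le {α β l : ℝ} (hα : 0 ≤ α) (hβ : 0 ≤ β) (hl : α + β = l) :
    (∫ s in (0 : ℝ)..α, g s) + ∫ s in (0 : ℝ)..β, g s ≤ 2 * ∫ s in (0 : ℝ)..(l / 2), g s := by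
  -- wlog α ≤ β
  wlog hle : α ≤ β generalizing α β
  · have := this hβ hα (by linarith) (by linarith)
    linarith
  have hβ2 : l / 2 ≤ β := by linarith
  have hα2 : α ≤ l / 2 := by linarith
  -- ∫_0^β = ∫_0^{l/2} + ∫_{l/2}^β, and ∫_{l/2}^β g = ∫_α^{l/2} g(· + (β − l/2)) ≤ ∫_α^{l/2} g
  have hsplitβ := (intervalIntegral.integral_add_adjacent_intervals (hint 0 (l / 2)) (hint (l / 2) β)).symm
  have hsplitm := (intervalIntegral.integral_add_adjacent_intervals (hint 0 α) (hint α (l / 2))).symm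
  have hshift : ∫ s in (l / 2)..β, g s = ∫ s in α..(l / 2), g (s + (β - l / 2)) := by
    have h := intervalIntegral.integral_comp_add_right g (β - l / 2) (a := α) (b := l / 2)
    rw [show α + (β - l / 2) = l / 2 by linarith, show l / 2 + (β - l / 2) = β by ring] at h
    exact h.symm
  have hcmp : ∫ s in α..(l / 2), g (s + (β - l / 2)) ≤ ∫ s in α..(l / 2), g s :=
    integral_comp_add_right_le_of_antitoneOn hg hint hα hα2 (by linarith)
  rw [hsplitβ, hshift]
  linarith

/-- **Symmetric-decreasing comparison**: for `g` antitone on `(0, ∞)` (interval-integrable), every `y₀`, `y⋆` and `h ≥ 0`: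
`∫_{y₀}^{y₀+h} g(|y − y⋆|) dy ≤ 2·∫₀^{h/2} g` — the integral of a symmetric decreasing profile over a window of length `h` is largest when the
window is centred. [cite: HardyLittlewoodPolya1952, §10.12 (378)] -/
theorem integral_comp_abs_sub_le_two_mul {y₀ h : ℝ} (hh : 0 ≤ h) (ys : ℝ) :
    ∫ y in y₀..(y₀ + h), g |y - ys| ≤ 2 * ∫ s in (0 : ℝ)..(h / 2), g s := by
  -- translate: u = y − y⋆
  have htr : ∫ y in y₀..(y₀ + h), g |y - ys| = ∫ u in (y₀ - ys)..(y₀ - ys + h), g |u| := by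
    have h1 := intervalIntegral.integral_comp_sub_right (fun u => g |u|) ys (a := y₀) (b := y₀ + h)
    rw [show y₀ + h - ys = y₀ - ys + h by ring] at h1
    exact h1
  rw [htr]
  set a := y₀ - ys with ha
  -- integrability of u ↦ g |u| on any interval
  have hintabs : ∀ c d : ℝ, IntervalIntegrable (fun u => g |u|) volume c d := by
    intro c d
    -- on [0, ∞): g|u| = g u; on (−∞, 0]: g|u| = g(−u)
    have hp : ∀ e : ℝ, 0 ≤ e → IntervalIntegrable (fun u => g |u|) volume 0 e := by
      intro e he
      refine (hint 0 e).congr ?_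
      intro u hu
      rw [uIoc_of_le he] at hu
      simp only [abs_of_pos hu.1]
    have hn : ∀ e : ℝ, e ≤ 0 → IntervalIntegrable (fun u => g |u|) volume e 0 := by
      intro e he
      have h1 : IntervalIntegrable (fun u => g (0 - u)) volume (0 - 0) (0 - (-e)) := (hint 0 (-e)).comp_sub_left 0
      simp only [sub_zero, zero_sub, neg_neg] at h1
      refine (h1.symm.congr ?_)
      intro u hu
      rw [uIoc_of_le he] at hu
      simp only [abs_of_nonpos hu.2]
    have h0 : ∀ e : ℝ, IntervalIntegrable (fun u => g |u|) volume 0 e := by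
      intro e
      rcases le_total 0 e with he | he
      · exact hp e he
      · exact (hn e he).symm
    exact (h0 c).symm.trans (h0 d)
  rcases le_or_gt 0 a with ha0 | ha0
  · -- window to the right of the centre: g|u| = g u
    have heq : ∫ u in a..(a + h), g |u| = ∫ u in a..(a + h), g u := by
      refine intervalIntegral.integral_congr_ae ?_
      rw [uIoc_of_le (by linarith)]
      filter_upwards with u hu
      rw [abs_of_pos (lt_of_le_of_lt ha0 hu.1)]
    rw [heq]
    calc ∫ u in a..(a + h), g u ≤ ∫ s in (0 : ℝ)..(a + h - a), g s := integral_le_integral_from_zero hg hint ha0 (by linarith)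
      _ = ∫ s in (0 : ℝ)..h, g s := by rw [show a + h - a = h by ring]
      _ ≤ 2 * ∫ s in (0 : ℝ)..(h / 2), g s := integral_zero_le_two_mul_half hg hint hh
  rcases le_or_gt (a + h) 0 with hb0 | hb0
  · -- window to the left of the centre: reflect, g|u| = g(−u)
    have heq : ∫ u in a..(a + h), g |u| = ∫ u in (-(a + h))..(-a), g u := by
      have h1 := intervalIntegral.integral_comp_neg (fun u => g |u|) (a := -(a + h)) (b := -a)
      -- h1 : ∫ x in -(a+h)..-a, g |-x| = ∫ x in -(-a) .. -(-(a+h)), g |x|  (up to orientation)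
      simp only [abs_neg, neg_neg] at h1
      rw [← h1]
      refine intervalIntegral.integral_congr_ae ?_
      rw [uIoc_of_le (by linarith)]
      filter_upwards with u hu
      rw [abs_of_pos (by linarith [hu.1])]
    rw [heq]
    calc ∫ u in (-(a + h))..(-a), g u ≤ ∫ s in (0 : ℝ)..(-a - -(a + h)), g s :=
          integral_le_integral_from_zero hg hint (by linarith) (by linarith)
      _ = ∫ s in (0 : ℝ)..h, g s := by rw [show -a - -(a + h) = h by ring]
      _ ≤ 2 * ∫ s in (0 : ℝ)..(h / 2), g s := integral_zero_le_two_mul_half hg hint hh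
  · -- the centre is inside: split at 0
    have hsplit := (intervalIntegral.integral_add_adjacent_intervals (hintabs a 0) (hintabs 0 (a + h))).symm
    rw [hsplit]
    have hleft : ∫ u in a..(0 : ℝ), g |u| = ∫ s in (0 : ℝ)..(-a), g s := by
      have h1 := intervalIntegral.integral_comp_neg (fun u => g |u|) (a := (0 : ℝ)) (b := -a)
      simp only [abs_neg, neg_neg, neg_zero] at h1
      rw [← h1]
      refine intervalIntegral.integral_congr_ae ?_
      rw [uIoc_of_le (by linarith)]
      filter_upwards with u hu
      rw [abs_of_pos hu.1]
    have hright : ∫ u in (0 : ℝ)..(a + h), g |u| = ∫ s in (0 : ℝ)..(a + h), g s := by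
      refine intervalIntegral.integral_congr_ae ?_
      rw [uIoc_of_le (by linarith)]
      filter_upwards with u hu
      rw [abs_of_pos hu.1]
    rw [hleft, hright]
    exact integral_two_pieces_le hg hint (by linarith) (by linarith) (by ring)

end Rearrangement

/-! ## §3 The slice integral: `∫ dy/(v|y − y⋆| + c) ≤ (2/v)·log(1 + v h/(2c))` -/

/-- `t ↦ (v|t| + c)⁻¹` is antitone on `(0, ∞)` (`v ≥ 0`, `c > 0`). [folklore] -/
theorem antitoneOn_inv_linear_abs {v c : ℝ} (hv : 0 ≤ v) (hc : 0 < c) :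
    AntitoneOn (fun t : ℝ => (v * |t| + c)⁻¹) (Ioi 0) := by
  intro s hs t ht hst
  have hs0 : 0 < s := hs
  have ht0 : 0 < t := ht
  simp only [abs_of_pos hs0, abs_of_pos ht0]
  exact inv_anti₀ (by positivity) (by nlinarith)

/-- `t ↦ (v|t| + c)⁻¹` is interval-integrable everywhere (continuous, `c > 0`, `v ≥ 0`). [folklore] -/
theorem intervalIntegrable_inv_linear_abs {v c : ℝ} (hv : 0 ≤ v) (hc : 0 < c) (a b : ℝ) :
    IntervalIntegrable (fun t : ℝ => (v * |t| + c)⁻¹) volume a b := by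
  refine (Continuous.continuousOn ?_).intervalIntegrable
  refine Continuous.inv₀ (by fun_prop) fun t => ?_
  have : 0 ≤ v * |t| := mul_nonneg hv (abs_nonneg t)
  linarith

/-- `∫₀^l dt/(v|t| + c) = (1/v)·log(1 + v l/c)` for `v, c > 0`, `l ≥ 0`. [folklore] -/
theorem integral_inv_linear_abs_eq {v c l : ℝ} (hv : 0 < v) (hc : 0 < c) (hl : 0 ≤ l) :
    ∫ t in (0 : ℝ)..l, (v * |t| + c)⁻¹ = v⁻¹ * Real.log (1 + v * l / c) := by
  have h1 : ∫ t in (0 : ℝ)..l, (v * |t| + c)⁻¹ = ∫ t in (0 : ℝ)..l, (v * t + c)⁻¹ := by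
    refine intervalIntegral.integral_congr_ae ?_
    rw [uIoc_of_le hl]
    filter_upwards with t ht
    rw [abs_of_pos ht.1]
  rw [h1, intervalIntegral.integral_comp_mul_add (fun x : ℝ => x⁻¹) hv.ne' c]
  simp only [mul_zero, zero_add, smul_eq_mul]
  rw [integral_inv_of_pos hc (by positivity)]
  congr 1
  rw [add_comm, add_div, div_self hc.ne', mul_div_assoc, add_comm]

/-- **The slice integral**: for `v, c > 0`, `h ≥ 0`, any `y₀`, `y⋆`: `∫_{y₀}^{y₀+h} dy/(v|y − y⋆| + c) ≤ (2/v)·log(1 + v h/(2c))`.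
[folklore] -/
theorem integral_inv_linear_abs_le {v c y₀ h : ℝ} (hv : 0 < v) (hc : 0 < c) (hh : 0 ≤ h) (ys : ℝ) :
    ∫ y in y₀..(y₀ + h), (v * |y - ys| + c)⁻¹ ≤ 2 / v * Real.log (1 + v * h / (2 * c)) := by
  have hmain := integral_comp_abs_sub_le_two_mul (antitoneOn_inv_linear_abs hv.le hc) (intervalIntegrable_inv_linear_abs hv.le hc)
    (y₀ := y₀) hh ys
  simp only [abs_abs] at hmain
  rw [integral_inv_linear_abs_eq hv hc (by linarith)] at hmain
  calc ∫ y in y₀..(y₀ + h), (v * |y - ys| + c)⁻¹ ≤ 2 * (v⁻¹ * Real.log (1 + v * (h / 2) / c)) := hmain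
    _ = 2 / v * Real.log (1 + v * h / (2 * c)) := by
        rw [show v * (h / 2) / c = v * h / (2 * c) by field_simp]
        ring

/-! ## §4 The outer integral: `∫ log(1 + A/|x − x†|) dx ≤ h·log(1 + 2A/h) + h` -/

/-- `t ↦ log(|t| + A) − log t` (`= log(1 + A/|t|)` off `0`; recall `Real.log |t| = Real.log t`) is antitone on `(0, ∞)` for `A ≥ 0`. [folklore] -/
theorem antitoneOn_log_add_sub_log {A : ℝ} (hA : 0 ≤ A) :
    AntitoneOn (fun t : ℝ => Real.log (|t| + A) - Real.log t) (Ioi 0) := by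
  intro s hs t ht hst
  have hs0 : 0 < s := hs
  have ht0 : 0 < t := ht
  simp only [abs_of_pos hs0, abs_of_pos ht0]
  rw [← Real.log_div (by positivity) ht0.ne', ← Real.log_div (by positivity) hs0.ne']
  refine Real.log_le_log (by positivity) ?_
  rw [div_le_div_iff₀ ht0 hs0]
  nlinarith

/-- `t ↦ log(|t| + A) − log t` is interval-integrable everywhere (`A > 0`). [folklore] -/
theorem intervalIntegrable_log_add_sub_log {A : ℝ} (hA : 0 < A) (a b : ℝ) :
    IntervalIntegrable (fun t : ℝ => Real.log (|t| + A) - Real.log t) volume a b := by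
  refine IntervalIntegrable.sub ?_ intervalIntegral.intervalIntegrable_log'
  refine (Continuous.continuousOn ?_).intervalIntegrable
  exact Continuous.log (by fun_prop) fun t => by have := abs_nonneg t; linarith

/-- `∫₀^l (log(|t| + A) − log t) dt = (A + l) log(A + l) − A log A − l log l` (`l ≥ 0`, any `A`; `integral_log` through `0`). [folklore] -/
theorem integral_log_add_sub_log_eq {A l : ℝ} (hl : 0 ≤ l) :
    ∫ t in (0 : ℝ)..l, (Real.log (|t| + A) - Real.log t) =
      (A + l) * Real.log (A + l) - A * Real.log A - l * Real.log l := by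
  have h1 : ∫ t in (0 : ℝ)..l, (Real.log (|t| + A) - Real.log t) = ∫ t in (0 : ℝ)..l, (Real.log (t + A) - Real.log t) := by
    refine intervalIntegral.integral_congr_ae ?_
    rw [uIoc_of_le hl]
    filter_upwards with t ht
    rw [abs_of_pos ht.1]
  have hlogA : IntervalIntegrable (fun t : ℝ => Real.log (t + A)) volume 0 l := by
    simpa using (intervalIntegral.intervalIntegrable_log' (a := 0 + A) (b := l + A)).comp_add_right A
  rw [h1, intervalIntegral.integral_sub hlogA intervalIntegral.intervalIntegrable_log',
    intervalIntegral.integral_comp_add_right (fun t => Real.log t) A, integral_log, integral_log]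
  simp only [zero_add, Real.log_zero, mul_zero, sub_zero]
  ring

/-- The elementary bound `(A + l) log(A + l) − A log A − l log l ≤ l·log(1 + A/l) + l` (`A, l > 0`): the left side is
`l log(1 + A/l) + A log(1 + l/A)` and `log(1 + s) ≤ s`. [folklore] -/
theorem log_combo_le {A l : ℝ} (hA : 0 < A) (hl : 0 < l) :
    (A + l) * Real.log (A + l) - A * Real.log A - l * Real.log l ≤ l * Real.log (1 + A / l) + l := by
  have e1 : Real.log (1 + A / l) = Real.log (A + l) - Real.log l := by
    rw [← Real.log_div (by positivity) hl.ne']; congr 1; field_simp; ring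
  have e2 : Real.log ((A + l) / A) ≤ (A + l) / A - 1 := Real.log_le_sub_one_of_pos (by positivity)
  rw [Real.log_div (by positivity) hA.ne'] at e2
  have e3 : A * (Real.log (A + l) - Real.log A) ≤ l := by
    have := mul_le_mul_of_nonneg_left e2 hA.le
    rw [show A * ((A + l) / A - 1) = l by field_simp; ring] at this
    exact this
  rw [e1]
  nlinarith

/-- **The outer integral**: for `A, h > 0`, any `x₀`, `x†`:
`∫_{x₀}^{x₀+h} (log(|x − x†| + A) − log|x − x†|) dx ≤ h·log(1 + 2A/h) + h`. [folklore] -/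
theorem integral_log_one_add_div_abs_le {A x₀ h : ℝ} (hA : 0 < A) (hh : 0 < h) (xs : ℝ) :
    ∫ x in x₀..(x₀ + h), (Real.log (|x - xs| + A) - Real.log |x - xs|) ≤ h * Real.log (1 + 2 * A / h) + h := by
  have hmain := integral_comp_abs_sub_le_two_mul (antitoneOn_log_add_sub_log hA.le) (intervalIntegrable_log_add_sub_log hA)
    (y₀ := x₀) hh.le xs
  simp only [abs_abs] at hmain
  rw [integral_log_add_sub_log_eq (A := A) (by linarith)] at hmain
  have hb := log_combo_le hA (l := h / 2) (by linarith)
  rw [show A / (h / 2) = 2 * A / h by field_simp] at hb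
  linarith

end Summit.HubbardSuperconductivity.HubbardSuperconductivity.Theorems.KlLindhardEnclosure

end
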